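import Summits.QuantumFields.YangMills.Theorems.PoincareLipschitzMinimiserSecondVariation
import HarnessLib

/-!
# Crux `BlockLipschitzL` (stmt-QuantumFields-23533) ∕ `HistoryTailL` (stmt-QuantumFields-19936), LINE 25 «CompactnessTransfer»,
# K2 continuum face, row (RS) `MinimisingMapSmoothness` — FILE (RS-a)-2 «THE SECOND VARIATION OF A BALL MINIMISER IN ONE DIRECTION»

Cell `ym3-torus` (YM ladder rung R3 = continuum SU(2) Yang–Mills on T³ — a RUNG, NOT the Clay problem: not d = 4, not infinite
volume, not a mass gap); WIDTH helper seat `ym-ust-19936-w7` g14 (LEAD ★w1-19936 g10 2026-08-29T14:39:36Z «(RS-a) at own risk,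
helper class, keep it limit-free»).  THEOREMS ONLY (0 `def`, 0 `sorry`, default heartbeats); imports FILE (RS-a)-1
✓`PoincareLipschitzMinimiserSecondVariation` (tangency, the normalised competitor `N(U + tζe)` and its exact a.e. density) and
through it the letters ✓`…MinimiserStabilityLetters` (the pure-ℝ one-sided second-order bound ✓`density_le_expansion`).

THE OBJECT.  `U` weakly differentiable on the open `Ω ⊆ ℝ³` with weak gradient `G`, UNIT on `Ω` (values in a real Hilbert space
`F`), of finite energy, minimising on the ball `B_ρ(y) ⊆ Ω` among finite-energy unit `W^{1,2}(Ω)` competitors agreeing with `U` off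
some `B_{ρ″}(y)`, `ρ″ < ρ` (w2 g13's `hmin` row VERBATIM = the minimality clause of lit `MinimisingMapSmoothness` ∕ `…Compactness`);
a unit vector `e`; a test function `ζ` with `tsupport ζ ⊆ B_{ρ′}(y)`, `ρ′ < ρ`, normalised `|ζ| ≤ 1`, `‖∇ζ‖ ≤ 1`.

WHAT THIS FILE PROVES.
* §1 integrability on the ball of the first∕second-order densities of the expansion and of the remainder density:
  `integrableOn_ball_of_le` (domination by `K(1 + dens G)`), `integrableOn_Q₁`, `integrableOn_Q₂`, `integrableOn_R`, with
  `Q₁(e) = Σᵢ 2(∂ᵢζ⟪G eᵢ,e⟫ − ζ⟪U,e⟫‖G eᵢ‖²)`,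
  `Q₂(e) = Σᵢ [(∂ᵢζ)²(1 − ⟪U,e⟫²) − 6ζ∂ᵢζ⟪U,e⟫⟪G eᵢ,e⟫ − ζ²‖G eᵢ‖² − ζ²⟪G eᵢ,e⟫² + 4ζ²⟪U,e⟫²‖G eᵢ‖²]`, `R = dens G + Σᵢ(∂ᵢζ)²`.
* §2 ★★★ `secondVariation_direction` — for `|t| ≤ ¼` and the universal `S` of ✓`density_le_expansion`:
  `0 ≤ t·∫_B Q₁(e) + t²·∫_B Q₂(e) + |t|³·S·∫_B R` — minimality against `N(U + tζe)` read through the pointwise second-order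
  bound; NO limits, no dominated convergence.
The sum over an orthonormal basis and the stability inequality `(n − 3)∫ζ²·dens G ≤ (n − 1)∫|∇ζ|²` [SchoenUhlenbeck1984 (1.3)–(1.5)]
are FILE (RS-a)-3 ✓`PoincareLipschitzMinimiserStability`.
HONEST SCOPE.  Calculus of variations for Sobolev maps; nothing of (RS), (C), S1″, K1, `MeanDeviationL`, `BlockLipschitzL`, `HistoryTailL`
is proved here; YM₃ on T³ is rung R3, not Clay; YM gap NOT proved; no summit statement is proved here.

References: R. Schoen, K. Uhlenbeck, Invent. Math. 78 (1984) 89–100 [SchoenUhlenbeck1984] (§1 (1.3)); L. Simon, Theorems on Regularity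
and Singularity of Energy Minimizing Maps (1996) [Simon1996] (§2.2).
-/

set_option autoImplicit false

noncomputable section

open MeasureTheory Set Function Filter Topology Metric TopologicalSpace
open scoped ContDiff RealInnerProductSpace BigOperators

namespace Summit.QuantumFields.YangMills.Theorems.PoincareLipschitzMinimiserSecondVariationDirection

open Literature.Analysis.FunctionSpaces (IsTestFunctionOn HasWeakFDerivOn)
open Summit.QuantumFields.YangMills.Theorems.PoincareLipschitzAxialStationarityLetters
open Summit.QuantumFields.YangMills.Theorems.PoincareLipschitzMinimiserStabilityLetters
open Summit.QuantumFields.YangMills.Theorems.PoincareLipschitzMinimiserSecondVariation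

variable {F : Type*} [NormedAddCommGroup F] [InnerProductSpace ℝ F] [CompleteSpace F]

/-! ## §1 Integrability of the expansion densities on the ball -/

omit [CompleteSpace F] in
/-- **Domination on a ball**: an a.e.-strongly measurable `f` with `|f| ≤ K·(1 + dens G)` on `Ω ⊇ B_ρ(y)` is integrable on the ball.
[folklore] -/
theorem integrableOn_ball_of_le {Ω : Opens (EuclideanSpace ℝ (Fin 3))}
    {G : EuclideanSpace ℝ (Fin 3) → EuclideanSpace ℝ (Fin 3) →L[ℝ] F}
    (hGi : IntegrableOn (fun x => ∑ i : Fin 3, ‖G x (EuclideanSpace.single i (1:ℝ))‖ ^ 2) (Ω : Set _) volume)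
    {y : EuclideanSpace ℝ (Fin 3)} {ρ : ℝ} (hB : ball y ρ ⊆ (Ω : Set _)) {f : EuclideanSpace ℝ (Fin 3) → ℝ}
    (hf : AEStronglyMeasurable f (volume.restrict (ball y ρ))) (K : ℝ)
    (hle : ∀ x ∈ (Ω : Set (EuclideanSpace ℝ (Fin 3))), |f x| ≤ K * (1 + ∑ i : Fin 3, ‖G x (EuclideanSpace.single i (1:ℝ))‖ ^ 2)) :
    IntegrableOn f (ball y ρ) volume := by
  have hfin : volume (ball y ρ) < ⊤ := measure_ball_lt_top
  have hdom : IntegrableOn (fun x => K * (1 + ∑ i : Fin 3, ‖G x (EuclideanSpace.single i (1:ℝ))‖ ^ 2)) (ball y ρ) volume :=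
    ((integrableOn_const hfin.ne).add (hGi.mono_set hB)).const_mul K
  refine Integrable.mono' hdom hf ?_
  filter_upwards [ae_restrict_mem measurableSet_ball] with x hx
  rw [Real.norm_eq_abs]
  exact hle x (hB hx)

omit [CompleteSpace F] in
/-- **The first-order density `Q₁(e)` is integrable on the ball** (`|Q₁| ≤ 3(1 + dens G)` from `|∂ᵢζ|, |ζ|, |⟪U,e⟫| ≤ 1`,
`|⟪G eᵢ, e⟫| ≤ ‖G eᵢ‖ ≤ (1 + ‖G eᵢ‖²)∕2`). [folklore] -/
theorem integrableOn_Q₁ {Ω : Opens (EuclideanSpace ℝ (Fin 3))}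
    {U : EuclideanSpace ℝ (Fin 3) → F} {G : EuclideanSpace ℝ (Fin 3) → EuclideanSpace ℝ (Fin 3) →L[ℝ] F}
    (hU : HasWeakFDerivOn Ω volume U G) (hU1 : ∀ x ∈ (Ω : Set (EuclideanSpace ℝ (Fin 3))), ‖U x‖ = 1)
    (hGi : IntegrableOn (fun x => ∑ i : Fin 3, ‖G x (EuclideanSpace.single i (1:ℝ))‖ ^ 2) (Ω : Set _) volume)
    {y : EuclideanSpace ℝ (Fin 3)} {ρ : ℝ} (hB : ball y ρ ⊆ (Ω : Set _)) {e : F} (he : ‖e‖ = 1)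
    {ζ : EuclideanSpace ℝ (Fin 3) → ℝ} (hζ : ContDiff ℝ ∞ ζ) (hζ1 : ∀ x, |ζ x| ≤ 1) (hζ'1 : ∀ x, ‖fderiv ℝ ζ x‖ ≤ 1) :
    IntegrableOn (fun x => ∑ i : Fin 3, 2 * (fderiv ℝ ζ x (EuclideanSpace.single i (1:ℝ)) *
      ⟪G x (EuclideanSpace.single i (1:ℝ)), e⟫ - ζ x * ⟪U x, e⟫ * ‖G x (EuclideanSpace.single i (1:ℝ))‖ ^ 2)) (ball y ρ) volume := by
  have hζ'c : Continuous (fderiv ℝ ζ) := hζ.continuous_fderiv (by simp)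
  have hUm : AEStronglyMeasurable U (volume.restrict (ball y ρ)) := (hU.locallyIntegrableOn.aestronglyMeasurable).mono_set hB
  have hGm : AEStronglyMeasurable G (volume.restrict (ball y ρ)) := (hU.locallyIntegrableOn_deriv.aestronglyMeasurable).mono_set hB
  have hGim : ∀ i : Fin 3, AEStronglyMeasurable (fun x => G x (EuclideanSpace.single i (1:ℝ))) (volume.restrict (ball y ρ)) :=
    fun i => (ContinuousLinearMap.apply ℝ F (EuclideanSpace.single i (1:ℝ))).continuous.comp_aestronglyMeasurable hGm
  have hbm : AEStronglyMeasurable (fun x => ⟪U x, e⟫) (volume.restrict (ball y ρ)) := hUm.inner aestronglyMeasurable_const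
  have hcm : ∀ i : Fin 3, AEStronglyMeasurable (fun x => ⟪G x (EuclideanSpace.single i (1:ℝ)), e⟫) (volume.restrict (ball y ρ)) :=
    fun i => (hGim i).inner aestronglyMeasurable_const
  have hgm : ∀ i : Fin 3, AEStronglyMeasurable (fun x => ‖G x (EuclideanSpace.single i (1:ℝ))‖ ^ 2) (volume.restrict (ball y ρ)) :=
    fun i => (hGim i).norm.pow 2
  have ham : ∀ i : Fin 3, AEStronglyMeasurable (fun x => fderiv ℝ ζ x (EuclideanSpace.single i (1:ℝ))) (volume.restrict (ball y ρ)) :=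
    fun i => (hζ'c.clm_apply continuous_const).aestronglyMeasurable
  have hzm : AEStronglyMeasurable ζ (volume.restrict (ball y ρ)) := hζ.continuous.aestronglyMeasurable
  refine integrable_finsetSum _ fun i _ => ?_
  refine integrableOn_ball_of_le hGi hB ((((ham i).mul (hcm i)).sub ((hzm.mul hbm).mul (hgm i))).const_mul 2) 3 ?_
  intro x hx
  have h1 : |fderiv ℝ ζ x (EuclideanSpace.single i (1:ℝ))| ≤ 1 := abs_apply_single_le (hζ'1 x) i
  have h2 : |⟪G x (EuclideanSpace.single i (1:ℝ)), e⟫| ≤ ‖G x (EuclideanSpace.single i (1:ℝ))‖ := by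
    have := abs_real_inner_le_norm (G x (EuclideanSpace.single i (1:ℝ))) e; rw [he, mul_one] at this; exact this
  have h3 := hζ1 x
  have h4 : |⟪U x, e⟫| ≤ 1 := by
    have := abs_real_inner_le_norm (U x) e; rw [hU1 x hx, he, one_mul] at this; exact this
  have hg := norm_nonneg (G x (EuclideanSpace.single i (1:ℝ)))
  have hG1 : ‖G x (EuclideanSpace.single i (1:ℝ))‖ ^ 2 ≤ ∑ j : Fin 3, ‖G x (EuclideanSpace.single j (1:ℝ))‖ ^ 2 :=
    Finset.single_le_sum (f := fun j : Fin 3 => ‖G x (EuclideanSpace.single j (1:ℝ))‖ ^ 2) (fun j _ => sq_nonneg _)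
      (Finset.mem_univ i)
  rw [abs_mul, abs_two]
  have h5 : |fderiv ℝ ζ x (EuclideanSpace.single i (1:ℝ)) * ⟪G x (EuclideanSpace.single i (1:ℝ)), e⟫| ≤
      ‖G x (EuclideanSpace.single i (1:ℝ))‖ := by
    rw [abs_mul]
    calc _ ≤ 1 * ‖G x (EuclideanSpace.single i (1:ℝ))‖ := mul_le_mul h1 h2 (abs_nonneg _) zero_le_one
      _ = _ := one_mul _
  have h6 : |ζ x * ⟪U x, e⟫ * ‖G x (EuclideanSpace.single i (1:ℝ))‖ ^ 2| ≤ ‖G x (EuclideanSpace.single i (1:ℝ))‖ ^ 2 := by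
    rw [abs_mul, abs_mul, abs_of_nonneg (sq_nonneg ‖G x (EuclideanSpace.single i (1:ℝ))‖)]
    have : |ζ x| * |⟪U x, e⟫| ≤ 1 := by
      calc |ζ x| * |⟪U x, e⟫| ≤ 1 * 1 := mul_le_mul h3 h4 (abs_nonneg _) zero_le_one
        _ = 1 := one_mul _
    nlinarith [sq_nonneg ‖G x (EuclideanSpace.single i (1:ℝ))‖, abs_nonneg (ζ x), abs_nonneg ⟪U x, e⟫,
      mul_nonneg (abs_nonneg (ζ x)) (abs_nonneg ⟪U x, e⟫)]
  have h7 := (abs_sub _ _).trans (add_le_add h5 h6)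
  nlinarith [sq_nonneg (‖G x (EuclideanSpace.single i (1:ℝ))‖ - 1)]

omit [CompleteSpace F] in
/-- **The second-order density `Q₂(e)` is integrable on the ball** (`|Q₂| ≤ 12(1 + dens G)`). [folklore] -/
theorem integrableOn_Q₂ {Ω : Opens (EuclideanSpace ℝ (Fin 3))}
    {U : EuclideanSpace ℝ (Fin 3) → F} {G : EuclideanSpace ℝ (Fin 3) → EuclideanSpace ℝ (Fin 3) →L[ℝ] F}
    (hU : HasWeakFDerivOn Ω volume U G) (hU1 : ∀ x ∈ (Ω : Set (EuclideanSpace ℝ (Fin 3))), ‖U x‖ = 1)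
    (hGi : IntegrableOn (fun x => ∑ i : Fin 3, ‖G x (EuclideanSpace.single i (1:ℝ))‖ ^ 2) (Ω : Set _) volume)
    {y : EuclideanSpace ℝ (Fin 3)} {ρ : ℝ} (hB : ball y ρ ⊆ (Ω : Set _)) {e : F} (he : ‖e‖ = 1)
    {ζ : EuclideanSpace ℝ (Fin 3) → ℝ} (hζ : ContDiff ℝ ∞ ζ) (hζ1 : ∀ x, |ζ x| ≤ 1) (hζ'1 : ∀ x, ‖fderiv ℝ ζ x‖ ≤ 1) :
    IntegrableOn (fun x => ∑ i : Fin 3, (fderiv ℝ ζ x (EuclideanSpace.single i (1:ℝ)) ^ 2 * (1 - ⟪U x, e⟫ ^ 2) -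
      6 * ζ x * fderiv ℝ ζ x (EuclideanSpace.single i (1:ℝ)) * ⟪U x, e⟫ * ⟪G x (EuclideanSpace.single i (1:ℝ)), e⟫ -
      ζ x ^ 2 * ‖G x (EuclideanSpace.single i (1:ℝ))‖ ^ 2 - ζ x ^ 2 * ⟪G x (EuclideanSpace.single i (1:ℝ)), e⟫ ^ 2 +
      4 * ζ x ^ 2 * ⟪U x, e⟫ ^ 2 * ‖G x (EuclideanSpace.single i (1:ℝ))‖ ^ 2)) (ball y ρ) volume := by
  have hζ'c : Continuous (fderiv ℝ ζ) := hζ.continuous_fderiv (by simp)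
  have hUm : AEStronglyMeasurable U (volume.restrict (ball y ρ)) := (hU.locallyIntegrableOn.aestronglyMeasurable).mono_set hB
  have hGm : AEStronglyMeasurable G (volume.restrict (ball y ρ)) := (hU.locallyIntegrableOn_deriv.aestronglyMeasurable).mono_set hB
  have hGim : ∀ i : Fin 3, AEStronglyMeasurable (fun x => G x (EuclideanSpace.single i (1:ℝ))) (volume.restrict (ball y ρ)) :=
    fun i => (ContinuousLinearMap.apply ℝ F (EuclideanSpace.single i (1:ℝ))).continuous.comp_aestronglyMeasurable hGm
  have hbm : AEStronglyMeasurable (fun x => ⟪U x, e⟫) (volume.restrict (ball y ρ)) := hUm.inner aestronglyMeasurable_const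
  have hcm : ∀ i : Fin 3, AEStronglyMeasurable (fun x => ⟪G x (EuclideanSpace.single i (1:ℝ)), e⟫) (volume.restrict (ball y ρ)) :=
    fun i => (hGim i).inner aestronglyMeasurable_const
  have hgm : ∀ i : Fin 3, AEStronglyMeasurable (fun x => ‖G x (EuclideanSpace.single i (1:ℝ))‖ ^ 2) (volume.restrict (ball y ρ)) :=
    fun i => (hGim i).norm.pow 2
  have ham : ∀ i : Fin 3, AEStronglyMeasurable (fun x => fderiv ℝ ζ x (EuclideanSpace.single i (1:ℝ))) (volume.restrict (ball y ρ)) :=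
    fun i => (hζ'c.clm_apply continuous_const).aestronglyMeasurable
  have hzm : AEStronglyMeasurable ζ (volume.restrict (ball y ρ)) := hζ.continuous.aestronglyMeasurable
  refine integrable_finsetSum _ fun i _ => ?_
  have hm : AEStronglyMeasurable (fun x => fderiv ℝ ζ x (EuclideanSpace.single i (1:ℝ)) ^ 2 * (1 - ⟪U x, e⟫ ^ 2) -
      6 * ζ x * fderiv ℝ ζ x (EuclideanSpace.single i (1:ℝ)) * ⟪U x, e⟫ * ⟪G x (EuclideanSpace.single i (1:ℝ)), e⟫ -
      ζ x ^ 2 * ‖G x (EuclideanSpace.single i (1:ℝ))‖ ^ 2 - ζ x ^ 2 * ⟪G x (EuclideanSpace.single i (1:ℝ)), e⟫ ^ 2 +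
      4 * ζ x ^ 2 * ⟪U x, e⟫ ^ 2 * ‖G x (EuclideanSpace.single i (1:ℝ))‖ ^ 2) (volume.restrict (ball y ρ)) :=
    (((((ham i).pow 2).mul (aestronglyMeasurable_const.sub (hbm.pow 2))).sub
      (((((aestronglyMeasurable_const.mul hzm).mul (ham i)).mul hbm).mul (hcm i)))).sub
      ((hzm.pow 2).mul (hgm i))).sub ((hzm.pow 2).mul ((hcm i).pow 2)) |>.add
      ((((aestronglyMeasurable_const.mul (hzm.pow 2)).mul (hbm.pow 2)).mul (hgm i)))
  refine integrableOn_ball_of_le hGi hB hm 12 ?_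
  intro x hx
  have h1 : |fderiv ℝ ζ x (EuclideanSpace.single i (1:ℝ))| ≤ 1 := abs_apply_single_le (hζ'1 x) i
  have h2 : |⟪G x (EuclideanSpace.single i (1:ℝ)), e⟫| ≤ ‖G x (EuclideanSpace.single i (1:ℝ))‖ := by
    have := abs_real_inner_le_norm (G x (EuclideanSpace.single i (1:ℝ))) e; rw [he, mul_one] at this; exact this
  have h3 := hζ1 x
  have h4 : |⟪U x, e⟫| ≤ 1 := by
    have := abs_real_inner_le_norm (U x) e; rw [hU1 x hx, he, one_mul] at this; exact this
  have hg := norm_nonneg (G x (EuclideanSpace.single i (1:ℝ)))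
  have hG1 : ‖G x (EuclideanSpace.single i (1:ℝ))‖ ^ 2 ≤ ∑ j : Fin 3, ‖G x (EuclideanSpace.single j (1:ℝ))‖ ^ 2 :=
    Finset.single_le_sum (f := fun j : Fin 3 => ‖G x (EuclideanSpace.single j (1:ℝ))‖ ^ 2) (fun j _ => sq_nonneg _)
      (Finset.mem_univ i)
  have ha2 : fderiv ℝ ζ x (EuclideanSpace.single i (1:ℝ)) ^ 2 ≤ 1 := by
    rw [← sq_abs]; nlinarith [abs_nonneg (fderiv ℝ ζ x (EuclideanSpace.single i (1:ℝ)))]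
  have hz2 : ζ x ^ 2 ≤ 1 := by rw [← sq_abs]; nlinarith [abs_nonneg (ζ x)]
  have hb2 : ⟪U x, e⟫ ^ 2 ≤ 1 := by rw [← sq_abs]; nlinarith [abs_nonneg ⟪U x, e⟫]
  have hc2 : ⟪G x (EuclideanSpace.single i (1:ℝ)), e⟫ ^ 2 ≤ ‖G x (EuclideanSpace.single i (1:ℝ))‖ ^ 2 := by
    rw [← sq_abs]; exact pow_le_pow_left₀ (abs_nonneg _) h2 2
  -- term by term
  have t1 : |fderiv ℝ ζ x (EuclideanSpace.single i (1:ℝ)) ^ 2 * (1 - ⟪U x, e⟫ ^ 2)| ≤ 1 := by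
    rw [abs_mul, abs_of_nonneg (sq_nonneg (fderiv ℝ ζ x (EuclideanSpace.single i (1:ℝ)))), abs_of_nonneg (by nlinarith)]
    nlinarith [sq_nonneg (fderiv ℝ ζ x (EuclideanSpace.single i (1:ℝ))), sq_nonneg ⟪U x, e⟫]
  have t2 : |6 * ζ x * fderiv ℝ ζ x (EuclideanSpace.single i (1:ℝ)) * ⟪U x, e⟫ * ⟪G x (EuclideanSpace.single i (1:ℝ)), e⟫| ≤
      6 * ‖G x (EuclideanSpace.single i (1:ℝ))‖ := by
    rw [abs_mul, abs_mul, abs_mul, abs_mul, show |(6:ℝ)| = 6 by norm_num]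
    have h5 : |ζ x| * |fderiv ℝ ζ x (EuclideanSpace.single i (1:ℝ))| ≤ 1 := by
      calc _ ≤ 1 * 1 := mul_le_mul h3 h1 (abs_nonneg _) zero_le_one
        _ = 1 := one_mul _
    have h6 : |ζ x| * |fderiv ℝ ζ x (EuclideanSpace.single i (1:ℝ))| * |⟪U x, e⟫| ≤ 1 := by
      calc _ ≤ 1 * 1 := mul_le_mul h5 h4 (abs_nonneg _) zero_le_one
        _ = 1 := one_mul _
    have h7 : |ζ x| * |fderiv ℝ ζ x (EuclideanSpace.single i (1:ℝ))| * |⟪U x, e⟫| * |⟪G x (EuclideanSpace.single i (1:ℝ)), e⟫| ≤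
        1 * ‖G x (EuclideanSpace.single i (1:ℝ))‖ := mul_le_mul h6 h2 (abs_nonneg _) zero_le_one
    nlinarith
  have t3 : |ζ x ^ 2 * ‖G x (EuclideanSpace.single i (1:ℝ))‖ ^ 2| ≤ ‖G x (EuclideanSpace.single i (1:ℝ))‖ ^ 2 := by
    rw [abs_mul, abs_of_nonneg (sq_nonneg (ζ x)), abs_of_nonneg (sq_nonneg ‖G x (EuclideanSpace.single i (1:ℝ))‖)]
    nlinarith [sq_nonneg ‖G x (EuclideanSpace.single i (1:ℝ))‖, sq_nonneg (ζ x)]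
  have t4 : |ζ x ^ 2 * ⟪G x (EuclideanSpace.single i (1:ℝ)), e⟫ ^ 2| ≤ ‖G x (EuclideanSpace.single i (1:ℝ))‖ ^ 2 := by
    rw [abs_mul, abs_of_nonneg (sq_nonneg (ζ x)), abs_of_nonneg (sq_nonneg ⟪G x (EuclideanSpace.single i (1:ℝ)), e⟫)]
    nlinarith [sq_nonneg ⟪G x (EuclideanSpace.single i (1:ℝ)), e⟫, sq_nonneg (ζ x)]
  have t5 : |4 * ζ x ^ 2 * ⟪U x, e⟫ ^ 2 * ‖G x (EuclideanSpace.single i (1:ℝ))‖ ^ 2| ≤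
      4 * ‖G x (EuclideanSpace.single i (1:ℝ))‖ ^ 2 := by
    rw [abs_mul, abs_mul, abs_mul, abs_of_nonneg (sq_nonneg (ζ x)), abs_of_nonneg (sq_nonneg ⟪U x, e⟫),
      abs_of_nonneg (sq_nonneg ‖G x (EuclideanSpace.single i (1:ℝ))‖), show |(4:ℝ)| = 4 by norm_num]
    have : ζ x ^ 2 * ⟪U x, e⟫ ^ 2 ≤ 1 := by nlinarith [sq_nonneg (ζ x), sq_nonneg ⟪U x, e⟫]
    nlinarith [sq_nonneg ‖G x (EuclideanSpace.single i (1:ℝ))‖, sq_nonneg (ζ x), sq_nonneg ⟪U x, e⟫,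
      mul_nonneg (sq_nonneg (ζ x)) (sq_nonneg ⟪U x, e⟫)]
  have hsum := (abs_add_le _ _).trans (add_le_add ((abs_sub _ _).trans (add_le_add ((abs_sub _ _).trans (add_le_add
    ((abs_sub _ _).trans (add_le_add t1 t2)) t3)) t4)) t5)
  nlinarith [sq_nonneg (‖G x (EuclideanSpace.single i (1:ℝ))‖ - 1)]

omit [CompleteSpace F] in
/-- **The remainder density `dens G + |∇ζ|²` is integrable on the ball.** [folklore] -/
theorem integrableOn_R {Ω : Opens (EuclideanSpace ℝ (Fin 3))}
    {G : EuclideanSpace ℝ (Fin 3) → EuclideanSpace ℝ (Fin 3) →L[ℝ] F}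
    (hGi : IntegrableOn (fun x => ∑ i : Fin 3, ‖G x (EuclideanSpace.single i (1:ℝ))‖ ^ 2) (Ω : Set _) volume)
    {y : EuclideanSpace ℝ (Fin 3)} {ρ : ℝ} (hB : ball y ρ ⊆ (Ω : Set _))
    {ζ : EuclideanSpace ℝ (Fin 3) → ℝ} (hζ : ContDiff ℝ ∞ ζ) (hζ'1 : ∀ x, ‖fderiv ℝ ζ x‖ ≤ 1) :
    IntegrableOn (fun x => (∑ i : Fin 3, ‖G x (EuclideanSpace.single i (1:ℝ))‖ ^ 2) +
      ∑ i : Fin 3, fderiv ℝ ζ x (EuclideanSpace.single i (1:ℝ)) ^ 2) (ball y ρ) volume := by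
  have hζ'c : Continuous (fderiv ℝ ζ) := hζ.continuous_fderiv (by simp)
  refine (hGi.mono_set hB).add (integrable_finsetSum _ fun i _ => ?_)
  refine integrableOn_ball_of_le hGi hB (((hζ'c.clm_apply continuous_const).aestronglyMeasurable).pow 2) 1 fun x _ => ?_
  rw [abs_of_nonneg (sq_nonneg (fderiv ℝ ζ x (EuclideanSpace.single i (1:ℝ))))]
  have h1 : |fderiv ℝ ζ x (EuclideanSpace.single i (1:ℝ))| ≤ 1 := abs_apply_single_le (hζ'1 x) i
  have ha2 : fderiv ℝ ζ x (EuclideanSpace.single i (1:ℝ)) ^ 2 ≤ 1 := by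
    rw [← sq_abs]; nlinarith [abs_nonneg (fderiv ℝ ζ x (EuclideanSpace.single i (1:ℝ)))]
  have : 0 ≤ ∑ j : Fin 3, ‖G x (EuclideanSpace.single j (1:ℝ))‖ ^ 2 := Finset.sum_nonneg fun j _ => sq_nonneg _
  linarith

/-! ## §2 The one-direction inequality -/

/-- ★★ **THE ONE-DIRECTION INEQUALITY.**  For a unit vector `e`, a test function `ζ` (`tsupport ζ ⊆ B_{ρ′}(y)`, `ρ′ < ρ`, `|ζ| ≤ 1`,
`‖∇ζ‖ ≤ 1`), a constant `S` as in ✓`density_le_expansion`, and `|t| ≤ ¼`: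
`0 ≤ t·∫_B Q₁(e) + t²·∫_B Q₂(e) + |t|³·S·∫_B (dens G + Σᵢ(∂ᵢζ)²)` — minimality against the normalised competitor
`N(U + tζe)` read through the pointwise second-order bound; no limits. [cite: SchoenUhlenbeck1984, §1 (1.3)] -/
theorem secondVariation_direction {Ω : Opens (EuclideanSpace ℝ (Fin 3))}
    {U : EuclideanSpace ℝ (Fin 3) → F} {G : EuclideanSpace ℝ (Fin 3) → EuclideanSpace ℝ (Fin 3) →L[ℝ] F}
    (hU : HasWeakFDerivOn Ω volume U G) (hU1 : ∀ x ∈ (Ω : Set (EuclideanSpace ℝ (Fin 3))), ‖U x‖ = 1)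
    (hGi : IntegrableOn (fun x => ∑ i : Fin 3, ‖G x (EuclideanSpace.single i (1:ℝ))‖ ^ 2) (Ω : Set _) volume)
    {y : EuclideanSpace ℝ (Fin 3)} {ρ ρ' : ℝ} (hρ' : ρ' < ρ) (hB : ball y ρ ⊆ (Ω : Set _))
    (hmin : ∀ (W : EuclideanSpace ℝ (Fin 3) → F) (GW : EuclideanSpace ℝ (Fin 3) → EuclideanSpace ℝ (Fin 3) →L[ℝ] F),
      HasWeakFDerivOn Ω volume W GW → (∀ x ∈ (Ω : Set (EuclideanSpace ℝ (Fin 3))), ‖W x‖ = 1) →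
      IntegrableOn (fun x => ∑ i : Fin 3, ‖GW x (EuclideanSpace.single i (1:ℝ))‖ ^ 2) (Ω : Set _) volume →
      (∃ ρ'' : ℝ, ρ'' < ρ ∧ ∀ x, x ∉ ball y ρ'' → W x = U x) →
      ∫ x in ball y ρ, ∑ i : Fin 3, ‖G x (EuclideanSpace.single i (1:ℝ))‖ ^ 2 ≤
        ∫ x in ball y ρ, ∑ i : Fin 3, ‖GW x (EuclideanSpace.single i (1:ℝ))‖ ^ 2)
    {e : F} (he : ‖e‖ = 1)
    {ζ : EuclideanSpace ℝ (Fin 3) → ℝ} (hζ : ContDiff ℝ ∞ ζ) (hζs : tsupport ζ ⊆ ball y ρ')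
    (hζ1 : ∀ x, |ζ x| ≤ 1) (hζ'1 : ∀ x, ‖fderiv ℝ ζ x‖ ≤ 1)
    {S : ℝ} (hS : ∀ t a b c z g : ℝ, |t| ≤ 1 / 4 → |b| ≤ 1 → |z| ≤ 1 → 0 ≤ g → c ^ 2 ≤ g →
      ((1 + 2 * t * z * b + t ^ 2 * z ^ 2) * (g + 2 * t * a * c + t ^ 2 * a ^ 2) - (t * (a * b + z * c) + t ^ 2 * z * a) ^ 2) /
          (1 + 2 * t * z * b + t ^ 2 * z ^ 2) ^ 2 ≤
        g + t * (2 * (a * c - z * b * g)) +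
          t ^ 2 * (a ^ 2 * (1 - b ^ 2) - 6 * z * a * b * c - z ^ 2 * g - z ^ 2 * c ^ 2 + 4 * z ^ 2 * b ^ 2 * g) +
          |t| ^ 3 * S * (g + a ^ 2))
    {t : ℝ} (ht : |t| ≤ 1 / 4) :
    0 ≤ t * (∫ x in ball y ρ, ∑ i : Fin 3, 2 * (fderiv ℝ ζ x (EuclideanSpace.single i (1:ℝ)) *
            ⟪G x (EuclideanSpace.single i (1:ℝ)), e⟫ - ζ x * ⟪U x, e⟫ * ‖G x (EuclideanSpace.single i (1:ℝ))‖ ^ 2)) +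
        t ^ 2 * (∫ x in ball y ρ, ∑ i : Fin 3, (fderiv ℝ ζ x (EuclideanSpace.single i (1:ℝ)) ^ 2 * (1 - ⟪U x, e⟫ ^ 2) -
            6 * ζ x * fderiv ℝ ζ x (EuclideanSpace.single i (1:ℝ)) * ⟪U x, e⟫ * ⟪G x (EuclideanSpace.single i (1:ℝ)), e⟫ -
            ζ x ^ 2 * ‖G x (EuclideanSpace.single i (1:ℝ))‖ ^ 2 - ζ x ^ 2 * ⟪G x (EuclideanSpace.single i (1:ℝ)), e⟫ ^ 2 +
            4 * ζ x ^ 2 * ⟪U x, e⟫ ^ 2 * ‖G x (EuclideanSpace.single i (1:ℝ))‖ ^ 2)) +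
        |t| ^ 3 * S * (∫ x in ball y ρ, ((∑ i : Fin 3, ‖G x (EuclideanSpace.single i (1:ℝ))‖ ^ 2) +
            ∑ i : Fin 3, fderiv ℝ ζ x (EuclideanSpace.single i (1:ℝ)) ^ 2)) := by
  have hζc : HasCompactSupport ζ :=
    IsCompact.of_isClosed_subset (isCompact_closedBall y ρ') (isClosed_tsupport ζ) (hζs.trans ball_subset_closedBall)
  have hζ'c : Continuous (fderiv ℝ ζ) := hζ.continuous_fderiv (by simp)
  have hBm : MeasurableSet (ball y ρ) := measurableSet_ball
  -- the competitor and minimality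
  obtain ⟨W, GW, hW, hW1, hWi, hWU, hdens⟩ := exists_normalised_competitor hU hU1 hGi he hζ hζc hζ1 ht
  have hminW := hmin W GW hW hW1 hWi
    ⟨ρ', hρ', fun x hx => hWU x (image_eq_zero_of_notMem_tsupport fun h => hx (hζs h))⟩
  -- pointwise letters on `Ω` and the three integrable densities
  have hb1 : ∀ x ∈ (Ω : Set (EuclideanSpace ℝ (Fin 3))), |⟪U x, e⟫| ≤ 1 := fun x hx => by
    have := abs_real_inner_le_norm (U x) e; rw [hU1 x hx, he, one_mul] at this; exact this
  have hci2 : ∀ x (i : Fin 3), ⟪G x (EuclideanSpace.single i (1:ℝ)), e⟫ ^ 2 ≤ ‖G x (EuclideanSpace.single i (1:ℝ))‖ ^ 2 :=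
    fun x i => by
      have h : |⟪G x (EuclideanSpace.single i (1:ℝ)), e⟫| ≤ ‖G x (EuclideanSpace.single i (1:ℝ))‖ := by
        have := abs_real_inner_le_norm (G x (EuclideanSpace.single i (1:ℝ))) e; rw [he, mul_one] at this; exact this
      rw [← sq_abs]; exact pow_le_pow_left₀ (abs_nonneg _) h 2
  have hQ1 := integrableOn_Q₁ hU hU1 hGi hB he hζ hζ1 hζ'1
  have hQ2 := integrableOn_Q₂ hU hU1 hGi hB he hζ hζ1 hζ'1
  have hR := integrableOn_R hGi hB hζ hζ'1
  -- the pointwise bound on the ball, a.e.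
  have hGiB : IntegrableOn (fun x => ∑ i : Fin 3, ‖G x (EuclideanSpace.single i (1:ℝ))‖ ^ 2) (ball y ρ) volume := hGi.mono_set hB
  have hle : ∀ᵐ x ∂(volume.restrict (ball y ρ)), ∑ i : Fin 3, ‖GW x (EuclideanSpace.single i (1:ℝ))‖ ^ 2 ≤
      (∑ i : Fin 3, ‖G x (EuclideanSpace.single i (1:ℝ))‖ ^ 2) +
      t * (∑ i : Fin 3, 2 * (fderiv ℝ ζ x (EuclideanSpace.single i (1:ℝ)) *
            ⟪G x (EuclideanSpace.single i (1:ℝ)), e⟫ - ζ x * ⟪U x, e⟫ * ‖G x (EuclideanSpace.single i (1:ℝ))‖ ^ 2)) +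
      t ^ 2 * (∑ i : Fin 3, (fderiv ℝ ζ x (EuclideanSpace.single i (1:ℝ)) ^ 2 * (1 - ⟪U x, e⟫ ^ 2) -
            6 * ζ x * fderiv ℝ ζ x (EuclideanSpace.single i (1:ℝ)) * ⟪U x, e⟫ * ⟪G x (EuclideanSpace.single i (1:ℝ)), e⟫ -
            ζ x ^ 2 * ‖G x (EuclideanSpace.single i (1:ℝ))‖ ^ 2 - ζ x ^ 2 * ⟪G x (EuclideanSpace.single i (1:ℝ)), e⟫ ^ 2 +
            4 * ζ x ^ 2 * ⟪U x, e⟫ ^ 2 * ‖G x (EuclideanSpace.single i (1:ℝ))‖ ^ 2)) +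
      |t| ^ 3 * S * ((∑ i : Fin 3, ‖G x (EuclideanSpace.single i (1:ℝ))‖ ^ 2) +
            ∑ i : Fin 3, fderiv ℝ ζ x (EuclideanSpace.single i (1:ℝ)) ^ 2) := by
    filter_upwards [ae_restrict_of_ae_restrict_of_subset hB hdens, ae_restrict_mem hBm] with x hx hxB
    rw [hx]
    have key := fun i : Fin 3 => hS t (fderiv ℝ ζ x (EuclideanSpace.single i (1:ℝ))) ⟪U x, e⟫
      ⟪G x (EuclideanSpace.single i (1:ℝ)), e⟫ (ζ x) (‖G x (EuclideanSpace.single i (1:ℝ))‖ ^ 2) ht (hb1 x (hB hxB)) (hζ1 x)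
      (sq_nonneg _) (hci2 x i)
    refine (Finset.sum_le_sum fun i _ => key i).trans (le_of_eq ?_)
    simp only [Fin.sum_univ_three]
    ring
  -- integrate
  have hrhs : IntegrableOn (fun x => (∑ i : Fin 3, ‖G x (EuclideanSpace.single i (1:ℝ))‖ ^ 2) +
      t * (∑ i : Fin 3, 2 * (fderiv ℝ ζ x (EuclideanSpace.single i (1:ℝ)) *
            ⟪G x (EuclideanSpace.single i (1:ℝ)), e⟫ - ζ x * ⟪U x, e⟫ * ‖G x (EuclideanSpace.single i (1:ℝ))‖ ^ 2)) +
      t ^ 2 * (∑ i : Fin 3, (fderiv ℝ ζ x (EuclideanSpace.single i (1:ℝ)) ^ 2 * (1 - ⟪U x, e⟫ ^ 2) -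
            6 * ζ x * fderiv ℝ ζ x (EuclideanSpace.single i (1:ℝ)) * ⟪U x, e⟫ * ⟪G x (EuclideanSpace.single i (1:ℝ)), e⟫ -
            ζ x ^ 2 * ‖G x (EuclideanSpace.single i (1:ℝ))‖ ^ 2 - ζ x ^ 2 * ⟪G x (EuclideanSpace.single i (1:ℝ)), e⟫ ^ 2 +
            4 * ζ x ^ 2 * ⟪U x, e⟫ ^ 2 * ‖G x (EuclideanSpace.single i (1:ℝ))‖ ^ 2)) +
      |t| ^ 3 * S * ((∑ i : Fin 3, ‖G x (EuclideanSpace.single i (1:ℝ))‖ ^ 2) +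
            ∑ i : Fin 3, fderiv ℝ ζ x (EuclideanSpace.single i (1:ℝ)) ^ 2)) (ball y ρ) volume :=
    ((hGiB.add (hQ1.const_mul t)).add (hQ2.const_mul (t ^ 2))).add (hR.const_mul (|t| ^ 3 * S))
  have hint := integral_mono_ae (hWi.mono_set hB) hrhs hle
  have hI1 : IntegrableOn (fun x => (∑ i : Fin 3, ‖G x (EuclideanSpace.single i (1:ℝ))‖ ^ 2) +
      t * (∑ i : Fin 3, 2 * (fderiv ℝ ζ x (EuclideanSpace.single i (1:ℝ)) *
            ⟪G x (EuclideanSpace.single i (1:ℝ)), e⟫ - ζ x * ⟪U x, e⟫ * ‖G x (EuclideanSpace.single i (1:ℝ))‖ ^ 2))) (ball y ρ) volume :=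
    hGiB.add (hQ1.const_mul t)
  have hI2 : IntegrableOn (fun x => (∑ i : Fin 3, ‖G x (EuclideanSpace.single i (1:ℝ))‖ ^ 2) +
      t * (∑ i : Fin 3, 2 * (fderiv ℝ ζ x (EuclideanSpace.single i (1:ℝ)) *
            ⟪G x (EuclideanSpace.single i (1:ℝ)), e⟫ - ζ x * ⟪U x, e⟫ * ‖G x (EuclideanSpace.single i (1:ℝ))‖ ^ 2)) +
      t ^ 2 * (∑ i : Fin 3, (fderiv ℝ ζ x (EuclideanSpace.single i (1:ℝ)) ^ 2 * (1 - ⟪U x, e⟫ ^ 2) -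
            6 * ζ x * fderiv ℝ ζ x (EuclideanSpace.single i (1:ℝ)) * ⟪U x, e⟫ * ⟪G x (EuclideanSpace.single i (1:ℝ)), e⟫ -
            ζ x ^ 2 * ‖G x (EuclideanSpace.single i (1:ℝ))‖ ^ 2 - ζ x ^ 2 * ⟪G x (EuclideanSpace.single i (1:ℝ)), e⟫ ^ 2 +
            4 * ζ x ^ 2 * ⟪U x, e⟫ ^ 2 * ‖G x (EuclideanSpace.single i (1:ℝ))‖ ^ 2))) (ball y ρ) volume :=
    hI1.add (hQ2.const_mul (t ^ 2))
  have hI3 : IntegrableOn (fun x => |t| ^ 3 * S * ((∑ i : Fin 3, ‖G x (EuclideanSpace.single i (1:ℝ))‖ ^ 2) +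
      ∑ i : Fin 3, fderiv ℝ ζ x (EuclideanSpace.single i (1:ℝ)) ^ 2)) (ball y ρ) volume := hR.const_mul (|t| ^ 3 * S)
  have hsplit : ∫ x in ball y ρ, ((∑ i : Fin 3, ‖G x (EuclideanSpace.single i (1:ℝ))‖ ^ 2) +
      t * (∑ i : Fin 3, 2 * (fderiv ℝ ζ x (EuclideanSpace.single i (1:ℝ)) *
            ⟪G x (EuclideanSpace.single i (1:ℝ)), e⟫ - ζ x * ⟪U x, e⟫ * ‖G x (EuclideanSpace.single i (1:ℝ))‖ ^ 2)) +
      t ^ 2 * (∑ i : Fin 3, (fderiv ℝ ζ x (EuclideanSpace.single i (1:ℝ)) ^ 2 * (1 - ⟪U x, e⟫ ^ 2) -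
            6 * ζ x * fderiv ℝ ζ x (EuclideanSpace.single i (1:ℝ)) * ⟪U x, e⟫ * ⟪G x (EuclideanSpace.single i (1:ℝ)), e⟫ -
            ζ x ^ 2 * ‖G x (EuclideanSpace.single i (1:ℝ))‖ ^ 2 - ζ x ^ 2 * ⟪G x (EuclideanSpace.single i (1:ℝ)), e⟫ ^ 2 +
            4 * ζ x ^ 2 * ⟪U x, e⟫ ^ 2 * ‖G x (EuclideanSpace.single i (1:ℝ))‖ ^ 2)) +
      |t| ^ 3 * S * ((∑ i : Fin 3, ‖G x (EuclideanSpace.single i (1:ℝ))‖ ^ 2) +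
            ∑ i : Fin 3, fderiv ℝ ζ x (EuclideanSpace.single i (1:ℝ)) ^ 2)) =
      (∫ x in ball y ρ, ∑ i : Fin 3, ‖G x (EuclideanSpace.single i (1:ℝ))‖ ^ 2) +
      t * (∫ x in ball y ρ, ∑ i : Fin 3, 2 * (fderiv ℝ ζ x (EuclideanSpace.single i (1:ℝ)) *
            ⟪G x (EuclideanSpace.single i (1:ℝ)), e⟫ - ζ x * ⟪U x, e⟫ * ‖G x (EuclideanSpace.single i (1:ℝ))‖ ^ 2)) +
      t ^ 2 * (∫ x in ball y ρ, ∑ i : Fin 3, (fderiv ℝ ζ x (EuclideanSpace.single i (1:ℝ)) ^ 2 * (1 - ⟪U x, e⟫ ^ 2) -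
            6 * ζ x * fderiv ℝ ζ x (EuclideanSpace.single i (1:ℝ)) * ⟪U x, e⟫ * ⟪G x (EuclideanSpace.single i (1:ℝ)), e⟫ -
            ζ x ^ 2 * ‖G x (EuclideanSpace.single i (1:ℝ))‖ ^ 2 - ζ x ^ 2 * ⟪G x (EuclideanSpace.single i (1:ℝ)), e⟫ ^ 2 +
            4 * ζ x ^ 2 * ⟪U x, e⟫ ^ 2 * ‖G x (EuclideanSpace.single i (1:ℝ))‖ ^ 2)) +
      |t| ^ 3 * S * (∫ x in ball y ρ, ((∑ i : Fin 3, ‖G x (EuclideanSpace.single i (1:ℝ))‖ ^ 2) +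
            ∑ i : Fin 3, fderiv ℝ ζ x (EuclideanSpace.single i (1:ℝ)) ^ 2)) := by
    rw [integral_add hI2 hI3, integral_add hI1 (hQ2.const_mul (t ^ 2)), integral_add hGiB (hQ1.const_mul t),
      integral_const_mul, integral_const_mul, integral_const_mul]
  rw [hsplit] at hint
  beta_reduce at hint hminW
  linarith

end Summit.QuantumFields.YangMills.Theorems.PoincareLipschitzMinimiserSecondVariationDirection

end
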